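import Summits.ABC.IUTFork.Repair.ScalarShells
import Summits.ABC.IUTFork.Cor312NaiveThm311
import Summits.ABC.IUTFork.Cor312PinnedOperators
import HarnessLib

/-!
# IUT REPAIR branch (rung LADDER-ABC:A2.RP) — LAYER 2 over the SCALING shells: the naive data (a)(b)(c), columns and the typed
# [IUTchIII] Theorem 3.11 TRANSPORTED to `scalingShells p`, and the label-dependent (Ind2)-family sending `Ψ` onto the q-datum

MODEL DATA (toy definitions + folklore lemmas; no `Prop` fact, nothing asserted about print) of the abc-iut cell's IUT REPAIR branch,
by abc-iut-w4-d098 (gen 3) — the ONE BUILDER of the scaling-shells model (abc-iut-rp-plan RULINGS #11 (1)), layer 2 announced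
2026-08-26T07:04:55Z. TAKES NO SIDE on [IUTchIII] Cor. 3.12 or on any author; toys over abc-iut-c312-7's one-place `toyIndex` (`l⋇ = 2`).

CONTENT (template: abc-iut-w5-d247's `Cor312NaiveThm311` — constant vertical lines — re-typed over this seat's `Repair.ScalarShells`):
* §1 `sData p : MRData (scalingShells p)` (integral structures `B_0`, admissible regions the balls `sBall`, log-volume `sVol`, splitting
  monoid `Ψ_v = {(±q^{j²})_j}` = `NaiveWitness.Psi`), `sDegrees`, `sSituation` (the SAME data on every line), `sColumn` (sign-twisted
  columns, as naive), `sFull p : FullSituation toyIndex`;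
* §2 **`sFull_statement : (sFull p).Statement`** — the typed Thm. 3.11 (i) ∧ (ii) ∧ (iii) HOLDS over the scaling shells (none of its clauses
  is a log-volume-invariance clause: those live in Step (x) / `LogvolInvariant`, which FAIL here by `ScalarShells.sVol_image_sFam_pUnit`);
  `sColumn_kummerB`, `sColumn_frobΨ` (column Kummer image = `Ψ` at every `(n, m)`);
* §3 the LABEL-DEPENDENT (Ind2)-family **`sFamDep p c`** (`c : toyIndex.Label → ℚˣ`; scalar `c_j` on every factor at label `j`, so
  `line ∘ sFamDep c = c_j^{j+1} · line` and `B_k ↦ B_{k + (j+1)·v_p(c_j)}`), an element of `(Ind2)` hence of `⟨(Ind1) ∪ (Ind2)⟩`;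
* §4 **the Joshi/door-(b) move `cQ p := (1, 1, p⁻¹)`**: at label `2` the scalar `p^{−3}` carries `q^{4}` to `q`, at label `1` the identity —
  `starAut_cQ_Psi : starAut (sFamDep (cQ p)) v '' Ψ_v = PinnedWitness.qDatum p v` («the indeterminacy group of the scaling shells
  carries the Θ-pilot's splitting monoid ONTO the q-pilot's Kummer datum») and `map_cQ_mem_RLGP : (sData p).map (sFamDep (cQ p)) ∈ RLGP n`
  — the raw material for the per-row files (abc-iut-rp-s2 door (b): S holds under pins where Step (x) invariance fails; abc-iut-rp-j2
  `CandJoshi22`: H_J21-2 / H_J21-5 non-vacuously; abc-iut-rp-j1 `CandJoshi7`), which add their honest SETTING, `ρ`, `qK` on top.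
[claim: Mochizuki2012, status: disputed]
-/

noncomputable section

open Set

namespace Summit.ABC.IUTFork.Repair.ScalarShellsThm311

open Thm311 Cor312 Cor312.Checks Cor312.IdentifiedNonVacuity Cor312Vol.NaiveWitness Cor312Vol.UnitWitness Cor312Vol.PinnedWitness
  Literature.IUT.LogThetaLattice Summit.ABC.IUTFork.Repair.ScalarShells

variable (p : ℕ) [hp : Fact p.Prime]

/-! ## 1. The data, degrees, situation, columns over the scaling shells -/

omit hp in
/-- **The data (a)(b)(c) of every vertical line** over the scaling shells ([IUTchIII] Thm. 3.11 (i)): integral structures the unit balls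
`B_0`, admissible regions the balls, log-volume `μ(B_k) = −k·log p`, splitting monoid `Ψ_v = {(±q^{j²})_j}` acting coordinatewise,
number-field copy the global packet — abc-iut-w5-d247's `naiveData`, re-typed. [claim: Mochizuki2012, status: disputed] -/
def sData : MRData (scalingShells p) where
  shellPk := fun j vQ => sBall p ⊤ j vQ 0
  shellSub := fun j v => sBall p ⊤ j (toyIndex.over v) 0
  Adm := fun j vQ A => ∃ k, A = sBall p ⊤ j vQ k
  logvol := fun j vQ A => sVol p ⊤ j vQ A
  Ψ := fun v _ => Psi p v
  act := fun v _ y => LinearMap.pi fun j => (line j.1 (toyIndex.over v) (y j)) • LinearMap.proj j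
  Mmod := fun _ => Set.univ

omit hp in
/-- **(c)'s global realified Frobenioids**: objects `p^k𝒪`, degree `−k·log p`, region `B_k`. [claim: Mochizuki2012, status: disputed] -/
def sDegrees (j : toyIndex.LabelStar) : GlobalDegrees (scalingShells p) j where
  ObjMOD := ℤ
  Objmod := ℤ
  natIso := Equiv.refl ℤ
  deg := fun k => -(k : ℝ) * Real.log p
  region := fun k vQ => sBall p ⊤ j.1 vQ k

omit hp in
/-- **The SCALING SITUATION**: scaling shells, the same data on every vertical line (an `abbrev`: `.L` reduces to `scalingShells p`).
[claim: Mochizuki2012, status: disputed] -/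
abbrev sSituation : Situation toyIndex where
  L := scalingShells p
  D := fun _ => sData p
  G := fun _ j => sDegrees p j

omit hp in
/-- **The column `n`** ([IUTchIII] Thm. 3.11 (ii)): Frobenius-like data at `(n,m)` = the coric data twisted by `(−1)^m` (abc-iut-w5-d247's
`twist`), unit-group images `B_{m'+1}`, Frobenioid objects tagged copies of `ℤ`, Θ-pilot the object of index `1` — `naiveColumn`, re-typed.
[claim: Mochizuki2012, status: disputed] -/
def sColumn : Column (scalingShells p) where
  frobAdm := fun m j vQ A => ∃ k, (twist m : (scalingShells p).PacketAut) j vQ '' A = sBall p ⊤ j vQ k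
  frobLogvol := fun m j vQ A => sVol p ⊤ j vQ ((twist m : (scalingShells p).PacketAut) j vQ '' A)
  frobΨ := fun m v _ => (scalingShells p).starAut (twist m) v '' Psi p v
  frobMmod := fun m j => (scalingShells p).globalAut (twist m) j.1 '' Set.univ
  unitImage := fun _ m' j vQ => sBall p ⊤ j vQ ((m' : ℤ) + 1)
  ballImage := fun _ j vQ => sBall p ⊤ j vQ 0
  ObjLGP := ℤ
  frobObjLGP := FrobObj
  kumLGP := kum
  ObjLgp := ℤ
  frobObjLgp := FrobObj
  kumLgp := kum
  thetaPilot := fun m => ⟨(1, m), rfl⟩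

omit hp in
/-- **The full situation of [IUTchIII] Thm. 3.11 over the scaling shells** (link data: abc-iut-w5-d247's `naiveLink`). An `abbrev`.
[claim: Mochizuki2012, status: disputed] -/
abbrev sFull : FullSituation toyIndex where
  toSituation := sSituation p
  col := fun _ => sColumn p
  link := naiveLink

/-! ## 2. The typed Theorem 3.11 (i) ∧ (ii) ∧ (iii) holds over the scaling shells -/

omit hp in
/-- The sign twist acts by scalars of `⊤` and FIXES every ball (its scalars are `±1`, of valuation `0`). [folklore] -/
theorem image_sBall_twist (m : ℤ) (j : toyIndex.Label) (vQ : toyIndex.VQ) (k : ℤ) :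
    (twist m : (scalingShells p).PacketAut) j vQ '' sBall p ⊤ j vQ k = sBall p ⊤ j vQ k :=
  image_pBall_twist p m j vQ k

/-- (i): splitting monoids in the sub-packets (one place), degrees ARE global log-volumes, lines identical. [folklore] -/
theorem s_partI : (sFull p).PartI := by
  refine ⟨fun n v hv x _ j => ?_, fun n j k => ⟨fun vQ => ⟨k, rfl⟩, Set.toFinite _, ?_⟩, fun _ _ => rfl⟩
  · show x j ∈ signShells.SubPacket j.1 v
    rw [subPacket_eq_top]; trivial
  · rw [finsum_unique]
    exact (sVol_sBall p ⊤ j.1 _ k).symm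

omit hp in
/-- **(ii) (b) KummerB**: the sign-twisted Kummer image of the splitting monoid IS the splitting monoid (`Ψ_v` is torsion-saturated,
abc-iut-w5-d247's `image_Psi_of_actsBySigns`). [folklore] -/
theorem sColumn_kummerB (n : ℤ) : ((sFull p).col n).KummerB ((sFull p).D n) := fun m v _ =>
  image_Psi_of_actsBySigns p (twist_actsBySigns m) v

omit hp in
/-- (ii), column by column: KummerA (twist fixes balls), KummerB, KummerC (twist onto), (Ind3) = `B_{m'+1} ⊆ B_0`. [folklore] -/
theorem s_partII : (sFull p).toLatticeSituation.PartII := by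
  intro n
  refine (Column.partII_iff _ _).2 ⟨?_, sColumn_kummerB p n,
    fun m j => Set.image_univ_of_surjective ((scalingShells p).globalAut (twist m) j.1).surjective, ?_⟩
  · rintro m j vQ A ⟨k, rfl⟩
    exact ⟨⟨k, image_sBall_twist p m j vQ k⟩, congrArg (sVol p ⊤ j vQ) (image_sBall_twist p m j vQ k)⟩
  · refine ⟨fun m m' j vQ _ => sBall_mono p ⊤ j vQ (by omega), fun m j vQ h => absurd trivial h⟩

/-- (iii): as in the naive model (same link data). [folklore] -/
theorem s_partIII : (sFull p).PartIII := by
  refine ⟨naiveLink.partIIIa_holds, naiveLink.partIIIb_holds, ?_, ?_,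
    (sFull p).evalCompatUpToInd_of_multiradialCompat (s_partI p).2.2⟩
  · refine naiveLink.partIIIc_of_full (fun _ => rfl) fun n m => ?_
    rintro _ ⟨a, rfl⟩
    show unitIso a ≪≫ unitIso ((-1) ^ m.natAbs) = unitIso ((-1) ^ m.natAbs) ≪≫ unitIso a
    rw [unitIso_trans, unitIso_trans, mul_comm]
  · intro n m; exact Thm311.PolyIsoCalc.stabilized_full _ _

/-- **The typed [IUTchIII] Theorem 3.11 (i) ∧ (ii) ∧ (iii) HOLDS over the scaling shells.** [folklore] -/
theorem sFull_statement : (sFull p).Statement := ⟨s_partI p, s_partII p, s_partIII p⟩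

omit hp in
/-- The column-`n` Kummer image of the Frobenius-like splitting monoid at every `(n, m)` is `Ψ_v`. [folklore] -/
theorem sColumn_frobΨ (n m : ℤ) : ((sFull p).col n).frobΨ m = fun v _ => Psi p v :=
  funext fun v => funext fun hv => sColumn_kummerB p n m v hv

omit hp in
/-- The line-`n` data are `sData` and its splitting monoid is `Ψ`. [folklore] -/
theorem sFull_D (n : ℤ) : (sFull p).D n = sData p ∧ ((sFull p).D n).Ψ = fun v _ => Psi p v := ⟨rfl, rfl⟩

/-- **BUT Step (x) log-volume invariance FAILS**: the indeterminacy `sFam p` changes the log-volume of the admissible ball `B_k` at every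
label (from `ScalarShells.sVol_image_sFam_pUnit`) — so c312-1's `MRData.LogvolInvariant`-type hypotheses (abc-iut-w5-d230's `hvol` binder of
`PinnedRegionsHonest`) are NOT available over the scaling shells: exactly the door-(b) regime. [folklore] -/
theorem logvol_not_invariant (j : toyIndex.Label) (vQ : toyIndex.VQ) (k : ℤ) :
    ∃ Φ ∈ Subgroup.closure ((scalingShells p).Ind1Family ∪ (scalingShells p).Ind2Family),
      (sData p).Adm j vQ (sBall p ⊤ j vQ k) ∧
        (sData p).logvol j vQ (Φ j vQ '' sBall p ⊤ j vQ k) ≠ (sData p).logvol j vQ (sBall p ⊤ j vQ k) :=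
  ⟨sFam p ⊤ (pUnit p), sFam_mem_closure p ⊤ (pUnit_mem_top p), ⟨k, rfl⟩, (sVol_image_sFam_pUnit p ⊤ (pUnit_mem_top p) j vQ k).2⟩

/-! ## 3. Label-dependent (Ind2)-families -/

omit hp in
/-- **The LABEL-DEPENDENT (Ind2)-family** «at label `j`, multiply every summand of every factor by `c_j`» (`c : toyIndex.Label → ℚˣ`):
at each label it is `ScalarShells.sFam (c j)`. [claim: Mochizuki2012, status: disputed] -/
def sFamDep (c : toyIndex.Label → ℚˣ) : (scalingShells p).PacketAut := fun j vQ => sFam p ⊤ (c j) j vQ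

omit hp in
/-- `sFamDep c` is an (Ind2)-family (membership in (Ind2) is checked packet by packet). [folklore] -/
theorem sFamDep_mem_Ind2Family (c : toyIndex.Label → ℚˣ) : sFamDep p c ∈ (scalingShells p).Ind2Family := fun j vQ =>
  sFam_mem_Ind2Family p ⊤ (Subgroup.mem_top (c j)) j vQ

omit hp in
/-- … hence an element of `⟨(Ind1) ∪ (Ind2)⟩`. [folklore] -/
theorem sFamDep_mem_closure (c : toyIndex.Label → ℚˣ) :
    sFamDep p c ∈ Subgroup.closure ((scalingShells p).Ind1Family ∪ (scalingShells p).Ind2Family) :=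
  Subgroup.subset_closure (Or.inr (sFamDep_mem_Ind2Family p c))

omit hp in
/-- On the packet line at label `j`, `sFamDep c` is the scalar `c_j^{j+1}`. [folklore] -/
theorem line_sFamDep (c : toyIndex.Label → ℚˣ) (j : toyIndex.Label) (vQ : toyIndex.VQ) (x : (scalingShells p).Packet j vQ) :
    line j vQ (sFamDep p c j vQ x) = ((c j : ℚˣ) : ℚ) ^ ((j : ℕ) + 1) * line j vQ x :=
  line_sFam p ⊤ (c j) j vQ x

/-- `sFamDep c` maps `B_k` at label `j` onto `B_{k + (j+1)·v_p(c_j)}`. [folklore] -/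
theorem image_sBall_sFamDep (c : toyIndex.Label → ℚˣ) (j : toyIndex.Label) (vQ : toyIndex.VQ) (k : ℤ) :
    sFamDep p c j vQ '' sBall p ⊤ j vQ k = sBall p ⊤ j vQ (k + (((j : ℕ) + 1 : ℕ) : ℤ) * padicValRat p ((c j : ℚˣ) : ℚ)) :=
  image_sBall_sFam p ⊤ (c j) j vQ k

/-! ## 4. The move carrying the splitting monoid onto the q-pilot's Kummer datum -/

/-- **The door-(b) / Joshi scalar vector `cQ := (1, 1, p⁻¹)`**: identity at labels `0, 1`, the scalar `p⁻¹` (so `p^{−3}` on the cube packet)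
at label `2`. [claim: Mochizuki2012, status: disputed] -/
def cQ : toyIndex.Label → ℚˣ := fun j => if (j : ℕ) = 2 then (pUnit p)⁻¹ else 1

omit hp in
/-- The two labels of `𝔽_l^⋇` for `toyIndex`, as natural numbers. [folklore] -/
theorem labelStar_val_cases (j : toyIndex.LabelStar) : ((j.1 : toyIndex.Label) : ℕ) = 1 ∨ ((j.1 : toyIndex.Label) : ℕ) = 2 := by
  obtain ⟨⟨v, hv⟩, hj⟩ := j
  have h3 : v < 3 := hv
  have h0 : v ≠ 0 := fun h => hj (Fin.ext h)
  show v = 1 ∨ v = 2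
  omega

/-- The line scalar of `sFamDep cQ` at a label `j ∈ 𝔽_l^⋇` times the theta value `q^{j²}` is `q`: the identity at `j = 1`,
`p^{−3}·p⁴ = p` at `j = 2`. [folklore] -/
theorem cQ_scalar_mul_theta (j : toyIndex.LabelStar) :
    ((cQ p j.1 : ℚˣ) : ℚ) ^ (((j.1 : toyIndex.Label) : ℕ) + 1) * (p : ℚ) ^ (((j.1 : toyIndex.Label) : ℕ) ^ 2) = (p : ℚ) := by
  have hp0 : (p : ℚ) ≠ 0 := by exact_mod_cast hp.out.ne_zero
  rcases labelStar_val_cases j with hj | hj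
  · simp only [cQ, hj]
    norm_num
  · simp only [cQ, hj, if_true]
    rw [Units.val_inv_eq_inv_val]
    show ((p : ℚ))⁻¹ ^ (2 + 1) * (p : ℚ) ^ (2 ^ 2) = p
    rw [inv_pow, inv_mul_eq_iff_eq_mul₀ (pow_ne_zero _ hp0)]
    ring

/-- **`sFamDep cQ` carries the splitting monoid `Ψ_v = {(±q^{j²})_j}` ONTO the q-pilot's Kummer datum `{(±q)_j}`** (abc-iut-w4-d101's
`PinnedWitness.qDatum`): inside the indeterminacy group of the scaling shells the Θ-pilot's and the q-pilot's Kummer data are RELATED —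
what no sign/unit indeterminacy can do. [folklore] -/
theorem starAut_cQ_Psi (v : toyIndex.V) (hv : v ∈ toyIndex.Vbad) :
    (scalingShells p).starAut (sFamDep p (cQ p)) v '' Psi p v = qDatum p v hv := by
  have key : ∀ (f : (scalingShells p).StarPacket v) (j : toyIndex.LabelStar),
      line j.1 (toyIndex.over v) ((scalingShells p).starAut (sFamDep p (cQ p)) v f j) =
        ((cQ p j.1 : ℚˣ) : ℚ) ^ (((j.1 : toyIndex.Label) : ℕ) + 1) * line j.1 (toyIndex.over v) (f j) := fun f j =>
    line_sFamDep p (cQ p) j.1 (toyIndex.over v) (f j)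
  apply Set.Subset.antisymm
  · rintro _ ⟨f, hf, rfl⟩ j
    have hgoal : line j.1 (toyIndex.over v) ((scalingShells p).starAut (sFamDep p (cQ p)) v f j) = (p : ℚ) ∨
        line j.1 (toyIndex.over v) ((scalingShells p).starAut (sFamDep p (cQ p)) v f j) = -(p : ℚ) := by
      rw [key]
      rcases hf j with h | h
      · left; rw [h, cQ_scalar_mul_theta]
      · right; rw [h, mul_neg, cQ_scalar_mul_theta]
    rw [expOf_qData, pow_one]
    exact hgoal
  · intro g hg
    refine ⟨((scalingShells p).starAut (sFamDep p (cQ p)) v).symm g, fun j => ?_, LinearEquiv.apply_symm_apply _ _⟩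
    have h1 := key (((scalingShells p).starAut (sFamDep p (cQ p)) v).symm g) j
    rw [LinearEquiv.apply_symm_apply] at h1
    have hc : ((cQ p j.1 : ℚˣ) : ℚ) ^ (((j.1 : toyIndex.Label) : ℕ) + 1) ≠ 0 := pow_ne_zero _ (cQ p j.1).ne_zero
    have hval := cQ_scalar_mul_theta p j
    have hgj : line j.1 (toyIndex.over v) (g j) = (p : ℚ) ∨ line j.1 (toyIndex.over v) (g j) = -(p : ℚ) := by
      have h := hg j
      rw [expOf_qData, pow_one] at h
      exact h
    rcases hgj with h | h
    · left
      apply mul_left_cancel₀ hc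
      rw [← h1, h, hval]
    · right
      apply mul_left_cancel₀ hc
      rw [← h1, h, mul_neg, hval]

omit hp in
/-- The transported data `sData.map (sFamDep c)` is ONE indeterminacy move from `sData`. [folklore] -/
theorem indMoves_sData_map (c : toyIndex.Label → ℚˣ) : MRData.IndMoves (sData p) ((sData p).map (sFamDep p c)) :=
  ⟨sFamDep p c, Or.inr (sFamDep_mem_Ind2Family p c), rfl⟩

omit hp in
/-- **`(sData p).map (sFamDep c) ∈ ^{n,∘}ℜ^LGP`** for every line `n` and every label-dependent scalar vector `c`. [folklore] -/
theorem map_sFamDep_mem_RLGP (c : toyIndex.Label → ℚˣ) (n : ℤ) :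
    (sData p).map (sFamDep p c) ∈ (sFull p).toLatticeSituation.RLGP n := by
  show (sData p).map (sFamDep p c) ∈ MRData.RLGP (sData p)
  exact (MRData.mem_RLGP_iff _ _).2 ⟨sFamDep p c, sFamDep_mem_closure p c, rfl⟩

/-- **The splitting monoid of the transported datum `sData.map (sFamDep cQ)` IS the q-pilot's Kummer datum** — so for any region operator
`ρ`, `ρ qDatum = ρ D'.Ψ` with `D' ∈ ^{n,∘}ℜ^LGP`: the residual `PilotKummerIndRelated` will hold at every setting over `sFull p` whose
q-side Kummer datum is `qDatum` (per-row files). [folklore] -/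
theorem map_cQ_Psi : ((sData p).map (sFamDep p (cQ p))).Ψ = qDatum p :=
  funext fun v => funext fun hv => starAut_cQ_Psi p v hv

/-- Packaged for the per-row settings: an element of `^{n,∘}ℜ^LGP` whose splitting monoid is the q-datum. [folklore] -/
theorem exists_mem_RLGP_Psi_eq_qDatum (n : ℤ) :
    ∃ D' ∈ (sFull p).toLatticeSituation.RLGP n, D'.Ψ = qDatum p :=
  ⟨_, map_sFamDep_mem_RLGP p (cQ p) n, map_cQ_Psi p⟩

end Summit.ABC.IUTFork.Repair.ScalarShellsThm311

end
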